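import Mathlib.LinearAlgebra.Matrix.PosDef
import Literature.Analysis.Matrix.KyFanMaximumPrinciple
import HarnessLib

/-!
# Transport of an index-wise eigenvalue enclosure across a perturbation with a quadratic-form bound
# (`λ↓_j(A) ∈ (a, b]`, `|xᵀ(B − A)x| ≤ E·xᵀx` ⇒ `λ↓_j(B) ∈ [a − E, b + E]`), and the Frobenius form bound

Horn–Johnson, *Matrix Analysis* (2nd ed., CUP 2013), **Corollary 4.3.15** with (4.3.16) (held text
`book:horn2012-matrix-analysis` p0311): for Hermitian `A, B ∈ M_n`, `|λᵢ(A) − λᵢ(B)| ≤ ‖A − B‖₂` for each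
`i` in a consistent ordering — proved there from Weyl's inequalities 4.3.1; and the Frobenius norm of §5.6,
(5.6.0.2) (p0433), `‖A‖₂^{Frob} = (Σᵢⱼ |aᵢⱼ|²)^{1/2} = (σ₁² + ⋯ + σ_n²)^{1/2} ≥ σ₁(A)`, so the spectral norm in
(4.3.16) may be replaced by the Frobenius norm.

This file is the TRANSPORT STEP of an eigenvalue-enclosure certificate for a computed real symmetric block:
the enclosure is produced for the float matrix `A` that was actually diagonalised / factorised, and must be
moved to the matrix `B` it approximates (float assembly error with a certified Frobenius bound, then an
operator-norm truncation bound — two successive perturbations, each with a quadratic-form bound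
`|xᵀ(B − A)x| ≤ E·xᵀx`).  For REAL SYMMETRIC matrices and Mathlib's antitone `eigenvalues₀`:

* `abs_dotProduct_mulVec_le_of_sum_sq_le` — the FROBENIUS form bound in the shape an exact checker verifies:
  `Σᵢⱼ Δᵢⱼ² ≤ E²`, `0 ≤ E` ⇒ `|xᵀΔx| ≤ E·(x ⬝ x)` (Cauchy–Schwarz over the index pairs; no square root);
* `eigenvalues₀_mem_Icc_of_forall_abs_le` — **the transport**: `λ↓_j(A) ∈ (a, b]` and `|xᵀ(B − A)x| ≤ E·xᵀx`
  for all `x` ⇒ `λ↓_j(B) ∈ [a − E, b + E]` (Weyl (4.3.16) in quadratic-form form, from the tree's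
  `KyFan.eigenvalues₀_add_le_of_forall_le` / `add_le_eigenvalues₀_add_of_forall_ge`);
* `eigenvalues₀_mem_Ioc_of_forall_nonneg_le` — the ONE-SIDED variant for a perturbation that is positive
  semidefinite and bounded above (`0 ≤ xᵀ(B − A)x ≤ t·xᵀx` ⇒ `λ↓_j(B) ∈ (a, b + t]`), the shape of a
  compression / tail term added on the upper side only (Cor. 4.3.12 monotonicity).

Everything is proved; no definitions, no named facts.  NOT here: which bound a given engine's `E` is (that is
the engine's declaration); infinite-dimensional compressions.

## References
* [HornJohnson2013] R. A. Horn, C. R. Johnson, *Matrix Analysis*, 2nd ed., CUP 2013 — Cor. 4.3.15 /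
  (4.3.16) (p0311), Cor. 4.3.12 (p0310), §5.6 (5.6.0.2) (p0433).
-/

noncomputable section

open scoped Matrix

namespace Literature.Analysis.Matrix

namespace EigenvalueCount

open Finset _root_.Matrix KyFan

variable {ι : Type*} [Fintype ι] [DecidableEq ι]

/-! ### §1 The Frobenius quadratic-form bound -/

omit [DecidableEq ι] in
/-- **Frobenius form bound, checker shape.** If `Σᵢⱼ Δᵢⱼ² ≤ E²` with `0 ≤ E` then `|xᵀΔx| ≤ E·(x ⬝ x)` for
every real `x` (Cauchy–Schwarz on the `|ι|²` pairs: `(Σᵢⱼ Δᵢⱼ xᵢ xⱼ)² ≤ (Σᵢⱼ Δᵢⱼ²)(Σᵢⱼ xᵢ² xⱼ²)`; this is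
`‖Δ‖₂ ≤ ‖Δ‖_F` applied to the Rayleigh quotient). [cite: HornJohnson2013, §5.6 (5.6.0.2) (Frobenius norm ≥ σ₁)] -/
theorem abs_dotProduct_mulVec_le_of_sum_sq_le (Δ : Matrix ι ι ℝ) {E : ℝ} (hE : 0 ≤ E)
    (hF : ∑ i, ∑ j, Δ i j ^ 2 ≤ E ^ 2) (x : ι → ℝ) :
    |x ⬝ᵥ Δ *ᵥ x| ≤ E * (x ⬝ᵥ x) := by
  -- write the form as one sum over pairs
  have hform : x ⬝ᵥ Δ *ᵥ x = ∑ p ∈ univ ×ˢ univ, Δ p.1 p.2 * (x p.1 * x p.2) := by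
    rw [Finset.sum_product]
    simp only [dotProduct, mulVec, Finset.mul_sum]
    exact sum_congr rfl fun i _ => sum_congr rfl fun j _ => by ring
  have hxx : x ⬝ᵥ x = ∑ i, x i ^ 2 := by simp only [dotProduct, sq]
  have hpairs : ∑ p ∈ univ ×ˢ univ, (x p.1 * x p.2) ^ 2 = (x ⬝ᵥ x) ^ 2 := by
    rw [Finset.sum_product, hxx, sq, Finset.sum_mul]
    refine sum_congr rfl fun i _ => ?_
    rw [Finset.mul_sum]
    exact sum_congr rfl fun j _ => by ring
  have hFp : ∑ p ∈ univ ×ˢ univ, Δ p.1 p.2 ^ 2 = ∑ i, ∑ j, Δ i j ^ 2 := by rw [Finset.sum_product]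
  -- Cauchy–Schwarz
  have hcs := sum_mul_sq_le_sq_mul_sq (univ ×ˢ univ) (fun p : ι × ι => Δ p.1 p.2) (fun p => x p.1 * x p.2)
  rw [← hform, hpairs, hFp] at hcs
  have h2 : (x ⬝ᵥ Δ *ᵥ x) ^ 2 ≤ (E * (x ⬝ᵥ x)) ^ 2 := by
    rw [mul_pow]
    exact hcs.trans (mul_le_mul_of_nonneg_right hF (sq_nonneg _))
  have hnn : 0 ≤ E * (x ⬝ᵥ x) := mul_nonneg hE (by rw [hxx]; positivity)
  have := sq_le_sq.1 h2
  rwa [abs_of_nonneg hnn] at this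

/-! ### §2 Transport of an enclosure -/

variable {A B : Matrix ι ι ℝ}

/-- **Two-sided transport (Weyl (4.3.16), quadratic-form form).** If `λ↓_j(A) ∈ (a, b]` and
`|xᵀ(B − A)x| ≤ E·xᵀx` for every `x`, then `λ↓_j(B) ∈ [a − E, b + E]`.
[cite: HornJohnson2013, Cor. 4.3.15 eq. (4.3.16)] -/
theorem eigenvalues₀_mem_Icc_of_forall_abs_le (hA : A.IsHermitian) (hB : B.IsHermitian)
    (j : Fin (Fintype.card ι)) {a b E : ℝ} (hj : hA.eigenvalues₀ j ∈ Set.Ioc a b)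
    (hE : ∀ x : ι → ℝ, |x ⬝ᵥ (B - A) *ᵥ x| ≤ E * (x ⬝ᵥ x)) :
    hB.eigenvalues₀ j ∈ Set.Icc (a - E) (b + E) := by
  have hBA : (A + (B - A)).IsHermitian := by rw [add_sub_cancel]; exact hB
  have heq : hBA.eigenvalues₀ = hB.eigenvalues₀ := by congr 1; exact add_sub_cancel A B
  have hup := eigenvalues₀_add_le_of_forall_le hA hBA (fun x => (abs_le.1 (hE x)).2) j
  have hlo := add_le_eigenvalues₀_add_of_forall_ge hA hBA (m := -E)
    (fun x => by have := (abs_le.1 (hE x)).1; linarith) j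
  rw [heq] at hup hlo
  exact ⟨by linarith [hj.1], by linarith [hj.2]⟩

/-- The same transport for a CLOSED source interval: `λ↓_j(A) ∈ [a, b]`, `|xᵀ(B − A)x| ≤ E·xᵀx`
⇒ `λ↓_j(B) ∈ [a − E, b + E]` (for chaining two perturbations). [cite: HornJohnson2013, Cor. 4.3.15 eq. (4.3.16)] -/
theorem eigenvalues₀_mem_Icc_of_mem_Icc_of_forall_abs_le (hA : A.IsHermitian) (hB : B.IsHermitian)
    (j : Fin (Fintype.card ι)) {a b E : ℝ} (hj : hA.eigenvalues₀ j ∈ Set.Icc a b)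
    (hE : ∀ x : ι → ℝ, |x ⬝ᵥ (B - A) *ᵥ x| ≤ E * (x ⬝ᵥ x)) :
    hB.eigenvalues₀ j ∈ Set.Icc (a - E) (b + E) := by
  have hBA : (A + (B - A)).IsHermitian := by rw [add_sub_cancel]; exact hB
  have heq : hBA.eigenvalues₀ = hB.eigenvalues₀ := by congr 1; exact add_sub_cancel A B
  have hup := eigenvalues₀_add_le_of_forall_le hA hBA (fun x => (abs_le.1 (hE x)).2) j
  have hlo := add_le_eigenvalues₀_add_of_forall_ge hA hBA (m := -E)
    (fun x => by have := (abs_le.1 (hE x)).1; linarith) j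
  rw [heq] at hup hlo
  exact ⟨by linarith [hj.1], by linarith [hj.2]⟩

/-- **Chained transport** through two perturbations (e.g. a certified Frobenius bound `E₁` on the assembly
error followed by an operator-norm truncation bound `E₂`): `λ↓_j(A) ∈ (a, b]`, `|xᵀ(B − A)x| ≤ E₁·xᵀx`,
`|xᵀ(C − B)x| ≤ E₂·xᵀx` ⇒ `λ↓_j(C) ∈ [a − E₁ − E₂, b + E₁ + E₂]`. [cite: HornJohnson2013, Cor. 4.3.15 eq. (4.3.16)] -/
theorem eigenvalues₀_mem_Icc_of_two_perturbations {C : Matrix ι ι ℝ} (hA : A.IsHermitian)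
    (hB : B.IsHermitian) (hC : C.IsHermitian) (j : Fin (Fintype.card ι)) {a b E₁ E₂ : ℝ}
    (hj : hA.eigenvalues₀ j ∈ Set.Ioc a b) (h₁ : ∀ x : ι → ℝ, |x ⬝ᵥ (B - A) *ᵥ x| ≤ E₁ * (x ⬝ᵥ x))
    (h₂ : ∀ x : ι → ℝ, |x ⬝ᵥ (C - B) *ᵥ x| ≤ E₂ * (x ⬝ᵥ x)) :
    hC.eigenvalues₀ j ∈ Set.Icc (a - E₁ - E₂) (b + E₁ + E₂) :=
  eigenvalues₀_mem_Icc_of_mem_Icc_of_forall_abs_le hB hC j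
    (eigenvalues₀_mem_Icc_of_forall_abs_le hA hB j hj h₁) h₂

/-- **One-sided transport** for a perturbation that is positive semidefinite and bounded above: if
`λ↓_j(A) ∈ (a, b]` and `0 ≤ xᵀ(B − A)x ≤ t·xᵀx` for every `x`, then `λ↓_j(B) ∈ (a, b + t]` (the lower end
is kept by monotonicity, Cor. 4.3.12; the upper end moves by `t`, (4.3.16)).
[cite: HornJohnson2013, Cor. 4.3.12 with Cor. 4.3.15] -/
theorem eigenvalues₀_mem_Ioc_of_forall_nonneg_le (hA : A.IsHermitian) (hB : B.IsHermitian)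
    (j : Fin (Fintype.card ι)) {a b t : ℝ} (hj : hA.eigenvalues₀ j ∈ Set.Ioc a b)
    (h0 : ∀ x : ι → ℝ, 0 ≤ x ⬝ᵥ (B - A) *ᵥ x) (ht : ∀ x : ι → ℝ, x ⬝ᵥ (B - A) *ᵥ x ≤ t * (x ⬝ᵥ x)) :
    hB.eigenvalues₀ j ∈ Set.Ioc a (b + t) := by
  have hBA : (A + (B - A)).IsHermitian := by rw [add_sub_cancel]; exact hB
  have heq : hBA.eigenvalues₀ = hB.eigenvalues₀ := by congr 1; exact add_sub_cancel A B
  have hup := eigenvalues₀_add_le_of_forall_le hA hBA ht j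
  have hlo := eigenvalues₀_le_of_add_psd hA hBA h0 j
  rw [heq] at hup hlo
  exact ⟨lt_of_lt_of_le hj.1 hlo, by linarith [hj.2]⟩

end EigenvalueCount

end Literature.Analysis.Matrix

end
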